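import Summits.NavierStokesRegularity.NavierStokesRegularity.Theorems.CoreLogGasBlowupIsLocallyDrivenShellStretchingDepletion

/-!
# `CoreLogGas.LocallyDrivenIsTypeI` (crux A, stmt-NavierStokesRegularity-11290) is false as soon as ONE isolated-core
# collapse is Type II — negative lemma modulo `IsolatedCoreTypeIIBlowup` (lead c6 of line `registered`, 2026-08-17)

`--supports stmt-NavierStokesRegularity-11290`, lane `--negative-modulo IsolatedCoreTypeIIBlowup`; target
`Theorems/LocallyDrivenIsTypeI/Negative/`. The A-side twin of
`Theorems/BlowupIsLocallyDriven/Negative/BlowupIsLocallyDrivenFalseOfRigidFarStrainBlowup.lean` (p154961).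

Crux A (`Theses.CoreLogGas.LocallyDrivenIsTypeI`) claims: a maximal finite-energy classical solution from Clay data
whose deep near-maximum vorticity points `x` (canonical core radius `ρ`) feel, from the vorticity OUTSIDE `B(x, Mρ)`,
only a time-integrable symmetric strain — the locality package `H(M, t₀, g)` — blows up at the Type-I rate. The route's
own recorded risk (item docstring, `why_might_fail`) is the ISOLATED CORE: "a lone blob relaying to an ever smaller
daughter blob is 'locally driven' yet Type II in Tao's averaged cascade (Tao2016AveragedNS §5)". This file makes that
sentence a kernel fact about the typed crux.

* `locality_of_isolatedCore` — **the kinematic content.** For a classical Leray–Hopf solution from rapidly decaying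
  data on `[0, T)` (maximality not needed), if for some `M ≥ 1`, a macroscopic radius `R > 0`, a time `t₁ < T` and a
  time-INTEGRABLE amplitude `m` the vorticity in the SHELL between `M` core radii and `R` around every admissible deep
  centre is small in the dipole-strain weight, `∫_{B(x,R) ∖ B(x,Mρ)} ‖ω(t,y)‖ ‖x − y‖⁻³ dy ≤ m(t)` ("isolated core":
  no vorticity debris at the core scale; what lies beyond the fixed radius `R` is unrestricted), then the locality
  package `H(M, t₁, g)` of the crux holds with `g = 2A·|m| + C(√((R/3)⁻⁵)‖u(0)‖₂ + √((R/3)⁻³)‖∇u(t)‖₂)`. Ingredients, all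
  in the tree: depletion of the shell stretching (`Depletion.shellStretch_abs_le_depleted`, Constantin–Fefferman), the
  far-field strain bound at radius `R` from energy and enstrophy (`Registered.farFieldStrain`, Tao's local Biot–Savart
  law), the energy inequality and time-integrable enstrophy (`Registered.stub_enstrophyControl`). No global Biot–Savart
  representation is used.
* `IsolatedCoreTypeIIBlowup` — **the hypothesis (NOT constructible in the tree).** Some maximal finite-energy classical
  solution from Clay data is an isolated-core collapse in the above sense and does NOT blow up at the Type-I rate. An
  inhabitant is in particular a finite-time singularity of Navier–Stokes from Schwartz data (¬ Clay (A)) — hence the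
  `--negative-modulo` lane and no verdict change on the item; model inhabitant: the cascade geometry of Tao's averaged
  Navier–Stokes blow-up (each active eddy isolated at its own scale, Type II).
* `LocallyDrivenIsTypeI_false_of_IsolatedCoreTypeIIBlowup` — `IsolatedCoreTypeIIBlowup → ¬ LocallyDrivenIsTypeI`.
* `isolatedCore_isTypeIBlowup_of_locallyDrivenIsTypeI` — the contrapositive in positive form: under A every
  isolated-core collapse is Type I. This is the cleanly typed "isolated case" that A contains under every typing of
  locality (leads c3/c4 of this crux, Lines/registered-dead-c3.md §4, -c4.md §4.1): no locality hypothesis separates it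
  from the route's target `NoTypeII` (stmt-NavierStokesRegularity-0056), of which A is a one-line weakening
  (`CoreLogGasLocallyDrivenIsTypeIOfNoTypeII.stub_dominance`, p163947).

References: P. Constantin, C. Fefferman, Indiana Univ. Math. J. 42 (1993), §2; T. Tao, arXiv:1108.1165, §10;
T. Tao, J. Amer. Math. Soc. 29 (2016), §5 (averaged Navier–Stokes blow-up, cascade geometry).
-/

noncomputable section

open Set MeasureTheory Filter Topology Metric
open scoped RealInnerProductSpace ContDiff

-- justification: the namespace is fixed by the crux protocol (`Theorems/<CruxDecl>/Negative/`).
set_option linter.dupNamespace false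

namespace Summit.NavierStokesRegularity.NavierStokesRegularity.Theorems.LocallyDrivenIsTypeI.Negative

open Literature.Analysis.FluidPDE
open Summit.NavierStokesRegularity.NavierStokesRegularity.Theorems.BlowupIsLocallyDriven.Registered
open Summit.NavierStokesRegularity.NavierStokesRegularity.Theorems.BlowupIsLocallyDriven.Depletion

/-! ### The shell stretching against the weighted vorticity mass of the shell -/

/-- A continuous function times the dipole-strain weight `‖x − y‖⁻³` is integrable on a shell `B(x,r₂) ∖ B(x,r₁)`,
`r₁ > 0` (continuous on the compact closed shell). [folklore] -/
theorem integrableOn_mul_kernel_shell {φ : EuclideanSpace ℝ (Fin 3) → ℝ} (hφ : Continuous φ)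
    (x : EuclideanSpace ℝ (Fin 3)) {r₁ : ℝ} (r₂ : ℝ) (h₁ : 0 < r₁) :
    IntegrableOn (fun y => φ y * (‖x - y‖ ^ 3)⁻¹) (ball x r₂ \ ball x r₁) volume := by
  have hK : IsCompact (closedBall x r₂ \ ball x r₁) := (isCompact_closedBall x r₂).diff isOpen_ball
  have hcont : ContinuousOn (fun y => φ y * (‖x - y‖ ^ 3)⁻¹) (closedBall x r₂ \ ball x r₁) := by
    refine hφ.continuousOn.mul (ContinuousOn.inv₀ (by fun_prop) ?_)
    intro y hy
    have hr : r₁ ≤ ‖x - y‖ := by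
      have h2 := hy.2
      rw [mem_ball, dist_eq_norm, not_lt, norm_sub_rev] at h2
      exact h2
    exact pow_ne_zero 3 (h₁.trans_le hr).ne'
  exact (hcont.integrableOn_compact hK).mono_set fun y hy => ⟨ball_subset_closedBall hy.1, hy.2⟩

/-- **Shell stretching against the weighted vorticity mass.** There is an absolute `A ≥ 0` such that for every smooth
`v`, centre `x`, radii `0 < r₁ ≤ r₂` and unit `e`, the shell gradient of the crux (difference of the gradients at `x`
of the written-out Biot–Savart velocities of `1_{B(x,r₂)} curl v` and `1_{B(x,r₁)} curl v`) satisfies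
`|⟪D_shell e, e⟫| ≤ A ∫_{B(x,r₂) ∖ B(x,r₁)} ‖curl v(y)‖ ‖x − y‖⁻³ dy` (depletion `Depletion.shellStretch_abs_le_depleted`
followed by `‖ω − ⟪ω,e⟫e‖ ≤ 2‖ω‖`). [folklore] -/
theorem shellStretch_abs_le_weighted : ∃ A : ℝ, 0 ≤ A ∧
    ∀ (v : EuclideanSpace ℝ (Fin 3) → EuclideanSpace ℝ (Fin 3)) (x : EuclideanSpace ℝ (Fin 3)) (r₁ r₂ : ℝ)
      (e : EuclideanSpace ℝ (Fin 3)), ContDiff ℝ ∞ v → 0 < r₁ → r₁ ≤ r₂ → ‖e‖ = 1 →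
      |inner ℝ ((fderiv ℝ (fun z : EuclideanSpace ℝ (Fin 3) => ∫ y, (4 * Real.pi * ‖z - y‖ ^ 3)⁻¹ • Literature.Analysis.FluidPDE.cross ((Metric.ball x r₂).indicator (Literature.Analysis.FluidPDE.curl v) y) (z - y)) x
        - fderiv ℝ (fun z : EuclideanSpace ℝ (Fin 3) => ∫ y, (4 * Real.pi * ‖z - y‖ ^ 3)⁻¹ • Literature.Analysis.FluidPDE.cross ((Metric.ball x r₁).indicator (Literature.Analysis.FluidPDE.curl v) y) (z - y)) x) e) e|
        ≤ A * ∫ y in Metric.ball x r₂ \ Metric.ball x r₁, ‖Literature.Analysis.FluidPDE.curl v y‖ * (‖x - y‖ ^ 3)⁻¹ := by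
  obtain ⟨A, hA0, hA⟩ := shellStretch_abs_le_depleted
  refine ⟨2 * A, by positivity, fun v x r₁ r₂ e hv h₁ h₁₂ he => ?_⟩
  have hv1 : ContDiff ℝ 1 v := hv.of_le (by exact_mod_cast le_top)
  have hwc : Continuous (curl v) := continuous_curl hv1
  refine (hA v x r₁ r₂ e hv h₁ h₁₂ he).trans ?_
  have hmono : ∫ y in ball x r₂ \ ball x r₁, ‖curl v y - ⟪curl v y, e⟫ • e‖ * (‖x - y‖ ^ 3)⁻¹ ≤
      ∫ y in ball x r₂ \ ball x r₁, (2 * ‖curl v y‖) * (‖x - y‖ ^ 3)⁻¹ := by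
    refine setIntegral_mono_on
      (integrableOn_mul_kernel_shell ((continuous_sub_inner_smul e).comp hwc).norm x r₂ h₁)
      (integrableOn_mul_kernel_shell (continuous_const.mul hwc.norm) x r₂ h₁)
      (measurableSet_ball.diff measurableSet_ball) (fun y _ => ?_)
    exact mul_le_mul_of_nonneg_right (norm_sub_inner_smul_le he (curl v y))
      (inv_nonneg.2 (pow_nonneg (norm_nonneg _) 3))
  have hconst : ∫ y in ball x r₂ \ ball x r₁, (2 * ‖curl v y‖) * (‖x - y‖ ^ 3)⁻¹ =
      2 * ∫ y in ball x r₂ \ ball x r₁, ‖curl v y‖ * (‖x - y‖ ^ 3)⁻¹ := by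
    rw [← integral_const_mul]
    refine integral_congr_ae (Eventually.of_forall fun y => ?_)
    ring
  calc A * ∫ y in ball x r₂ \ ball x r₁, ‖curl v y - ⟪curl v y, e⟫ • e‖ * (‖x - y‖ ^ 3)⁻¹
      ≤ A * ∫ y in ball x r₂ \ ball x r₁, (2 * ‖curl v y‖) * (‖x - y‖ ^ 3)⁻¹ :=
        mul_le_mul_of_nonneg_left hmono hA0
    _ = 2 * A * ∫ y in ball x r₂ \ ball x r₁, ‖curl v y‖ * (‖x - y‖ ^ 3)⁻¹ := by rw [hconst]; ring

/-! ### Isolated cores satisfy the locality package `H` of the crux -/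

/-- **Isolated cores are locally driven (the kinematic content of this file).** Let `(u, p)` be a classical solution
of unforced Navier–Stokes on `ℝ³ × [0,T)` which is Leray–Hopf from a rapidly decaying datum. Suppose that for some
`M ≥ 1`, `R > 0`, `t₁ ∈ [0,T)` and an amplitude `m` integrable on `[t₁,T)`, at every `t ∈ [t₁,T)` and every admissible
pair `(x, ρ)` of the crux (deep near-maximum vorticity point `x`, inscribed quarter-max ball `B(x,ρ)` of near-largest
radius) with `Mρ ≤ R`, the shell vorticity is small in the dipole-strain weight:
`∫_{B(x,R) ∖ B(x,Mρ)} ‖ω(t,y)‖ ‖x − y‖⁻³ dy ≤ m(t)`. Then the locality package `H(M, t₁, g)` of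
`LocallyDrivenIsTypeI` / `BlowupIsLocallyDriven` holds, with
`g(t) = A|m(t)| + C(√((R/3)⁻⁵) ‖u(0)‖₂ + √((R/3)⁻³) ‖∇u(t)‖₂)` — shell by `shellStretch_abs_le_weighted`, far field
beyond `R` (or beyond `Mρ` when `Mρ > R`) by `Registered.farFieldStrain`, integrability by the energy inequality and
`Registered.stub_enstrophyControl`. [folklore] -/
theorem locality_of_isolatedCore {ν T : ℝ} (hν : 0 < ν) (hT : 0 < T)
    {u : ℝ → EuclideanSpace ℝ (Fin 3) → EuclideanSpace ℝ (Fin 3)} {p : ℝ → EuclideanSpace ℝ (Fin 3) → ℝ}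
    (hcl : Literature.Analysis.FluidPDE.IsClassicalNSSolutionOn (Set.Ico 0 T) ν 0 u p)
    (hlh : Literature.Analysis.FluidPDE.IsLerayHopfOn T ν 0 (u 0) u)
    (hdec : Literature.Analysis.FluidPDE.HasRapidSpatialDecay (u 0))
    {M R t₁ : ℝ} {m : ℝ → ℝ} (hM : 1 ≤ M) (hR : 0 < R) (ht₁ : 0 ≤ t₁) (ht₁T : t₁ < T)
    (hm : MeasureTheory.IntegrableOn m (Set.Ico t₁ T))
    (hcore : ∀ t ∈ Set.Ico t₁ T, ∀ (x : EuclideanSpace ℝ (Fin 3)) (ρ : ℝ), 0 < ρ → M * ρ ≤ R →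
      (⨆ z, ‖Literature.Analysis.FluidPDE.curl (u t) z‖) ≤ 2 * ‖Literature.Analysis.FluidPDE.curl (u t) x‖ →
      Metric.ball x ρ ⊆ {y | (⨆ z, ‖Literature.Analysis.FluidPDE.curl (u t) z‖) ≤ 4 * ‖Literature.Analysis.FluidPDE.curl (u t) y‖} →
      (∀ (x' : EuclideanSpace ℝ (Fin 3)) (ρ' : ℝ),
        (⨆ z, ‖Literature.Analysis.FluidPDE.curl (u t) z‖) ≤ 2 * ‖Literature.Analysis.FluidPDE.curl (u t) x'‖ →
        Metric.ball x' ρ' ⊆ {y | (⨆ z, ‖Literature.Analysis.FluidPDE.curl (u t) z‖) ≤ 4 * ‖Literature.Analysis.FluidPDE.curl (u t) y‖} →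
        ρ' ≤ 2 * ρ) →
      ∫ y in Metric.ball x R \ Metric.ball x (M * ρ), ‖Literature.Analysis.FluidPDE.curl (u t) y‖ * (‖x - y‖ ^ 3)⁻¹ ≤ m t) :
    ∃ (M' t₀ : ℝ) (g : ℝ → ℝ), 1 ≤ M' ∧ 0 ≤ t₀ ∧ t₀ < T ∧ MeasureTheory.IntegrableOn g (Set.Ico t₀ T) ∧
      ∀ t ∈ Set.Ico t₀ T, ∀ (x : EuclideanSpace ℝ (Fin 3)) (ρ : ℝ), 0 < ρ →
        (⨆ z, ‖Literature.Analysis.FluidPDE.curl (u t) z‖) ≤ 2 * ‖Literature.Analysis.FluidPDE.curl (u t) x‖ →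
        Metric.ball x ρ ⊆ {y | (⨆ z, ‖Literature.Analysis.FluidPDE.curl (u t) z‖) ≤ 4 * ‖Literature.Analysis.FluidPDE.curl (u t) y‖} →
        (∀ (x' : EuclideanSpace ℝ (Fin 3)) (ρ' : ℝ),
          (⨆ z, ‖Literature.Analysis.FluidPDE.curl (u t) z‖) ≤ 2 * ‖Literature.Analysis.FluidPDE.curl (u t) x'‖ →
          Metric.ball x' ρ' ⊆ {y | (⨆ z, ‖Literature.Analysis.FluidPDE.curl (u t) z‖) ≤ 4 * ‖Literature.Analysis.FluidPDE.curl (u t) y‖} →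
          ρ' ≤ 2 * ρ) →
        ∀ e : EuclideanSpace ℝ (Fin 3), ‖e‖ = 1 →
          |inner ℝ ((fderiv ℝ (u t) x - fderiv ℝ (fun z : EuclideanSpace ℝ (Fin 3) =>
            ∫ y, (4 * Real.pi * ‖z - y‖ ^ 3)⁻¹ • Literature.Analysis.FluidPDE.cross
              ((Metric.ball x (M' * ρ)).indicator (Literature.Analysis.FluidPDE.curl (u t)) y) (z - y)) x) e) e| ≤ g t := by
  obtain ⟨C, hC0, hC⟩ := farFieldStrain
  obtain ⟨A, hA0, hA⟩ := shellStretch_abs_le_weighted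
  obtain ⟨hint, hsq⟩ := stub_enstrophyControl ν T hν hT u p hcl hlh hdec
  -- the far-field majorant at radius `R` (opaque name)
  obtain ⟨Φ, hΦ⟩ : ∃ Φ : ℝ → ℝ, Φ = fun t => C * (Real.sqrt ((R / 3)⁻¹ ^ 5) * Real.sqrt (∫ y, ‖u 0 y‖ ^ 2) +
      Real.sqrt ((R / 3)⁻¹ ^ 3) * Real.sqrt (∫ y, ‖fderiv ℝ (u t) y‖ ^ 2)) := ⟨_, rfl⟩
  refine ⟨M, t₁, fun t => A * |m t| + Φ t, hM, ht₁, ht₁T, ?_, ?_⟩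
  · -- integrability of g on [t₁, T)
    have hsub : Set.Ico t₁ T ⊆ Set.Ico 0 T := Set.Ico_subset_Ico_left ht₁
    have hN : MeasureTheory.IntegrableOn (fun t => Real.sqrt (∫ y, ‖fderiv ℝ (u t) y‖ ^ 2)) (Set.Ico t₁ T)
        MeasureTheory.volume := hsq.mono_set hsub
    have hΦi : MeasureTheory.IntegrableOn Φ (Set.Ico t₁ T) MeasureTheory.volume := by
      have h1 : MeasureTheory.IntegrableOn (fun _ : ℝ => Real.sqrt ((R / 3)⁻¹ ^ 5) * Real.sqrt (∫ y, ‖u 0 y‖ ^ 2))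
          (Set.Ico t₁ T) MeasureTheory.volume := integrableOn_const (by simp)
      rw [hΦ]
      exact ((h1.add (hN.integrable.const_mul _)).integrable.const_mul C)
    exact (hm.integrable.abs.const_mul A).add hΦi
  · intro t ht x ρ hρ hpeak hball hmaxrad e he
    -- classical facts at the time slice t
    have ht' : t ∈ Set.Ico 0 T := ⟨ht₁.trans ht.1, ht.2⟩
    have hCi : ContDiff ℝ ∞ (u t) := hcl.contDiff_velocity ht'
    have hdiv : Literature.Analysis.FluidPDE.VectorCalculus.IsDivFree (u t) := hcl.divFree t ht'
    have hL2 : MeasureTheory.MemLp (u t) 2 MeasureTheory.volume := hlh.memLp t ⟨ht'.1, ht'.2.le⟩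
    have hgrad : MeasureTheory.Integrable (fun y => ‖fderiv ℝ (u t) y‖ ^ 2) MeasureTheory.volume := hint t ht'
    -- energy: `‖u t‖₂ ≤ ‖u 0‖₂`
    have hen : Real.sqrt (∫ y, ‖u t y‖ ^ 2) ≤ Real.sqrt (∫ y, ‖u 0 y‖ ^ 2) :=
      Real.sqrt_le_sqrt (farField_integral_norm_sq_le_datum hlh hν.le ⟨ht'.1, ht'.2.le⟩)
    -- the far-field bound at any radius `S ≥ R` is at most `Φ t`
    have hfar : ∀ S : ℝ, R ≤ S →
        |inner ℝ ((fderiv ℝ (u t) x - fderiv ℝ (fun z : EuclideanSpace ℝ (Fin 3) => ∫ y, (4 * Real.pi * ‖z - y‖ ^ 3)⁻¹ • Literature.Analysis.FluidPDE.cross ((Metric.ball x S).indicator (Literature.Analysis.FluidPDE.curl (u t)) y) (z - y)) x) e) e|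
          ≤ Φ t := by
      intro S hRS
      have hS : 0 < S := hR.trans_le hRS
      refine (hC (u t) hCi hdiv hL2 hgrad S hS x e he).trans ?_
      have hmono : ∀ k : ℕ, Real.sqrt ((S / 3)⁻¹ ^ k) ≤ Real.sqrt ((R / 3)⁻¹ ^ k) := by
        intro k
        apply Real.sqrt_le_sqrt
        apply pow_le_pow_left₀ (by positivity)
        exact inv_anti₀ (by positivity) (by linarith)
      rw [hΦ]
      have hb0 : 0 ≤ Real.sqrt (∫ y, ‖fderiv ℝ (u t) y‖ ^ 2) := Real.sqrt_nonneg _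
      refine mul_le_mul_of_nonneg_left (add_le_add ?_ ?_) hC0
      · exact mul_le_mul (hmono 5) hen (Real.sqrt_nonneg _) (Real.sqrt_nonneg _)
      · exact mul_le_mul_of_nonneg_right (hmono 3) hb0
    have hAm : 0 ≤ A * |m t| := mul_nonneg hA0 (abs_nonneg _)
    show _ ≤ A * |m t| + Φ t
    by_cases hcase : M * ρ ≤ R
    · -- split the exterior at radius R: far field + shell, the shell by the weighted vorticity mass
      have h1 := hfar R le_rfl
      have hMρ : 0 < M * ρ := mul_pos (by linarith) hρ
      have h2 : |inner ℝ ((fderiv ℝ (fun z : EuclideanSpace ℝ (Fin 3) => ∫ y, (4 * Real.pi * ‖z - y‖ ^ 3)⁻¹ • Literature.Analysis.FluidPDE.cross ((Metric.ball x R).indicator (Literature.Analysis.FluidPDE.curl (u t)) y) (z - y)) x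
          - fderiv ℝ (fun z : EuclideanSpace ℝ (Fin 3) => ∫ y, (4 * Real.pi * ‖z - y‖ ^ 3)⁻¹ • Literature.Analysis.FluidPDE.cross ((Metric.ball x (M * ρ)).indicator (Literature.Analysis.FluidPDE.curl (u t)) y) (z - y)) x) e) e|
          ≤ A * |m t| :=
        (hA (u t) x (M * ρ) R e hCi hMρ hcase he).trans
          (mul_le_mul_of_nonneg_left ((hcore t ht x ρ hρ hcase hpeak hball hmaxrad).trans (le_abs_self _)) hA0)
      exact (farField_abs_inner_sub_le_split _ _ _ e).trans ((add_le_add h1 h2).trans_eq (add_comm _ _))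
    · -- the M-ball already contains B(x,R): the far-field bound applies directly at radius M ρ
      exact (hfar (M * ρ) (lt_of_not_ge hcase).le).trans (le_add_of_nonneg_left hAm)

/-! ### The hypothesis and the negative lemma -/

/-- **Hypothesis `IsolatedCoreTypeIIBlowup` (NOT constructible in the tree; filed `--negative-modulo`).** Some maximal
finite-energy classical solution of unforced Navier–Stokes from Clay data (Leray–Hopf, rapidly decaying datum) does NOT
blow up at the Type-I rate `‖u(t)‖∞ ≤ C/√(T − t)`, while being an ISOLATED-CORE collapse: for some `M ≥ 1`, `R > 0`,
`t₁ < T` and a time-integrable amplitude `m`, at every admissible deep centre `(x, ρ)` of the crux with `Mρ ≤ R` the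
vorticity in the shell `B(x,R) ∖ B(x,Mρ)` has dipole-weighted mass `∫ ‖ω(t,y)‖ ‖x − y‖⁻³ dy ≤ m(t)` (no vorticity
debris at the core scale; the field beyond the fixed radius `R` is unrestricted). An inhabitant is in particular a
finite-time singularity from Schwartz data (¬ Clay (A)); the model inhabitant is the cascade geometry of Tao's averaged
Navier–Stokes blow-up (each active eddy isolated at its own scale, Type II; Tao, J. Amer. Math. Soc. 29 (2016), §5),
the item's recorded why-might-fail. -/
def IsolatedCoreTypeIIBlowup : Prop :=
  ∃ (ν T : ℝ) (u : ℝ → EuclideanSpace ℝ (Fin 3) → EuclideanSpace ℝ (Fin 3)) (p : ℝ → EuclideanSpace ℝ (Fin 3) → ℝ),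
    0 < ν ∧ 0 < T ∧
    Literature.Analysis.FluidPDE.IsMaximalSmoothSolution ν 0 u p T ∧
    Literature.Analysis.FluidPDE.IsLerayHopfOn T ν 0 (u 0) u ∧
    Literature.Analysis.FluidPDE.HasRapidSpatialDecay (u 0) ∧
    ¬ Literature.Analysis.FluidPDE.IsTypeIBlowup u T ∧
    ∃ (M R t₁ : ℝ) (m : ℝ → ℝ), 1 ≤ M ∧ 0 < R ∧ 0 ≤ t₁ ∧ t₁ < T ∧ MeasureTheory.IntegrableOn m (Set.Ico t₁ T) ∧
      ∀ t ∈ Set.Ico t₁ T, ∀ (x : EuclideanSpace ℝ (Fin 3)) (ρ : ℝ), 0 < ρ → M * ρ ≤ R →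
        (⨆ z, ‖Literature.Analysis.FluidPDE.curl (u t) z‖) ≤ 2 * ‖Literature.Analysis.FluidPDE.curl (u t) x‖ →
        Metric.ball x ρ ⊆ {y | (⨆ z, ‖Literature.Analysis.FluidPDE.curl (u t) z‖) ≤ 4 * ‖Literature.Analysis.FluidPDE.curl (u t) y‖} →
        (∀ (x' : EuclideanSpace ℝ (Fin 3)) (ρ' : ℝ),
          (⨆ z, ‖Literature.Analysis.FluidPDE.curl (u t) z‖) ≤ 2 * ‖Literature.Analysis.FluidPDE.curl (u t) x'‖ →
          Metric.ball x' ρ' ⊆ {y | (⨆ z, ‖Literature.Analysis.FluidPDE.curl (u t) z‖) ≤ 4 * ‖Literature.Analysis.FluidPDE.curl (u t) y‖} →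
          ρ' ≤ 2 * ρ) →
        ∫ y in Metric.ball x R \ Metric.ball x (M * ρ), ‖Literature.Analysis.FluidPDE.curl (u t) y‖ * (‖x - y‖ ^ 3)⁻¹ ≤ m t

/-- **The isolated case of crux A, in positive form.** Under `LocallyDrivenIsTypeI`, every maximal finite-energy
classical solution from Clay data which is an isolated-core collapse (shell vorticity of time-integrable dipole-weighted
mass around every admissible deep centre, for some `M ≥ 1` and `R > 0`) blows up at the Type-I rate. This is the
content of A that no typing of "locality" removes (Lines/registered-dead-c4.md §4.1): the conjectured mechanism for it
(the card's Kelvin budget) is the composition stubs `stub_fluxBudget` / `stub_kelvinInduction` / `stub_parabolicCore`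
of line `registered`, none of which has a source. [folklore] -/
theorem isolatedCore_isTypeIBlowup_of_locallyDrivenIsTypeI
    (hA : Summit.NavierStokesRegularity.NavierStokesRegularity.Theses.CoreLogGas.LocallyDrivenIsTypeI)
    {ν T : ℝ} (hν : 0 < ν) (hT : 0 < T)
    {u : ℝ → EuclideanSpace ℝ (Fin 3) → EuclideanSpace ℝ (Fin 3)} {p : ℝ → EuclideanSpace ℝ (Fin 3) → ℝ}
    (hmax : Literature.Analysis.FluidPDE.IsMaximalSmoothSolution ν 0 u p T)
    (hlh : Literature.Analysis.FluidPDE.IsLerayHopfOn T ν 0 (u 0) u)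
    (hdec : Literature.Analysis.FluidPDE.HasRapidSpatialDecay (u 0))
    {M R t₁ : ℝ} {m : ℝ → ℝ} (hM : 1 ≤ M) (hR : 0 < R) (ht₁ : 0 ≤ t₁) (ht₁T : t₁ < T)
    (hm : MeasureTheory.IntegrableOn m (Set.Ico t₁ T))
    (hcore : ∀ t ∈ Set.Ico t₁ T, ∀ (x : EuclideanSpace ℝ (Fin 3)) (ρ : ℝ), 0 < ρ → M * ρ ≤ R →
      (⨆ z, ‖Literature.Analysis.FluidPDE.curl (u t) z‖) ≤ 2 * ‖Literature.Analysis.FluidPDE.curl (u t) x‖ →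
      Metric.ball x ρ ⊆ {y | (⨆ z, ‖Literature.Analysis.FluidPDE.curl (u t) z‖) ≤ 4 * ‖Literature.Analysis.FluidPDE.curl (u t) y‖} →
      (∀ (x' : EuclideanSpace ℝ (Fin 3)) (ρ' : ℝ),
        (⨆ z, ‖Literature.Analysis.FluidPDE.curl (u t) z‖) ≤ 2 * ‖Literature.Analysis.FluidPDE.curl (u t) x'‖ →
        Metric.ball x' ρ' ⊆ {y | (⨆ z, ‖Literature.Analysis.FluidPDE.curl (u t) z‖) ≤ 4 * ‖Literature.Analysis.FluidPDE.curl (u t) y‖} →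
        ρ' ≤ 2 * ρ) →
      ∫ y in Metric.ball x R \ Metric.ball x (M * ρ), ‖Literature.Analysis.FluidPDE.curl (u t) y‖ * (‖x - y‖ ^ 3)⁻¹ ≤ m t) :
    Literature.Analysis.FluidPDE.IsTypeIBlowup u T :=
  hA ν T hν hT u p hmax hlh hdec (locality_of_isolatedCore hν hT hmax.1 hlh hdec hM hR ht₁ ht₁T hm hcore)

/-- **Crux A is false modulo `IsolatedCoreTypeIIBlowup`.** If one maximal finite-energy classical solution from Clay
data is an isolated-core collapse which is not Type I, then `CoreLogGas.LocallyDrivenIsTypeI` fails: by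
`locality_of_isolatedCore` that solution satisfies the locality package `H`, so A would make it Type I
(`isolatedCore_isTypeIBlowup_of_locallyDrivenIsTypeI`). [folklore] -/
theorem LocallyDrivenIsTypeI_false_of_IsolatedCoreTypeIIBlowup (hH : IsolatedCoreTypeIIBlowup) :
    ¬ Summit.NavierStokesRegularity.NavierStokesRegularity.Theses.CoreLogGas.LocallyDrivenIsTypeI := by
  intro hA
  obtain ⟨ν, T, u, p, hν, hT, hmax, hlh, hdec, hII, M, R, t₁, m, hM, hR, ht₁, ht₁T, hm, hcore⟩ := hH
  exact hII (isolatedCore_isTypeIBlowup_of_locallyDrivenIsTypeI hA hν hT hmax hlh hdec hM hR ht₁ ht₁T hm hcore)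

/-- **The same inhabitant kills the route's target.** An isolated-core Type-II collapse is in particular a maximal
solution from Clay data that is not Type I, i.e. a counterexample to `NoTypeII` (stmt-NavierStokesRegularity-0056) —
recorded to make explicit that this negative lemma does not separate A from the target it is dominated by. [folklore] -/
theorem NoTypeII_false_of_IsolatedCoreTypeIIBlowup (hH : IsolatedCoreTypeIIBlowup) :
    ¬ Summit.NavierStokesRegularity.NavierStokesRegularity.Theses.CoreLogGas.NoTypeII := by
  intro hN
  obtain ⟨ν, T, u, p, hν, hT, hmax, hlh, hdec, hII, -⟩ := hH
  exact hII (hN ν T hν hT u p hmax hlh hdec)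

end Summit.NavierStokesRegularity.NavierStokesRegularity.Theorems.LocallyDrivenIsTypeI.Negative
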